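import Summits.HodgeConjecture.HodgeConjecture.Theorems.MarkmanPartnerTransportK3Sq2RealMultiplicationResidue

/-!
# Route MarkmanPartnerTransport · crux #5 `LowPicardRealMultiplication` — the DEGREE of the real multiplication
# forced by `¬ SpannedByIsometries`: `d · n = 23 − ρ(X)` with `d ≥ 2`, `n ≥ 3`

Sharpening of `exists_realMultiplication_of_not_spannedByIsometries` (`…K3Sq2RealMultiplicationResidue`): under
`¬ SpannedByIsometries X φ` the endomorphism field `E = End_Hdg(T(X)_ℚ)` of the period datum is a totally real
field `≠ ℚ`, so by van Geemen's `dim_ℚ T(X) = [E:ℚ] · m` with `m ≥ 3` (tree theorem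
`exists_three_le_finrank_eq_mul`) and the tower `[E:ℚ] = [ℚ(r):ℚ] · [E:ℚ(r)]`, the real irrational eigenvalue
`ev = ε(r)` of the real-multiplication endomorphism has `d = deg minpoly_ℚ(ev) ≥ 2` with `d · n = 23 − ρ(X)` for
some `n ≥ 3`:

* `exists_natDegree_minpoly_mul` (abstract carriers), `two_le_natDegree_minpoly_of_not_mem_bot`;
* `exists_realMultiplication_degree_of_not_spannedByIsometries` — the endomorphism with its degree data;
* `natDegree_realMultiplication_of_picard_two/_one/_three` — **at `ρ(X) = 2` the crux's regime is real
  multiplication by a totally real field met through an eigenvalue of degree `3` or `7`; at `ρ(X) = 1` of degree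
  `2`; at `ρ(X) = 3` of degree `2`, `4` or `5`** — so the one-cycle clause of `…K3Sq2OneCycleFifth{,RM}` asks, at
  `ρ(X) = 2`, for a cycle acting on `σ` by a cubic or septic irrationality.

No definition, no sorry, no named-fact hypothesis. Prover seat hodge-nonav-19652-p1 (gen 8),
`--supports stmt-HodgeConjecture-19653`. Nothing here proves the crux or HC.

References: B. van Geemen, Michigan Math. J. 56 (2008) Lemma 3.2; Yu. Zarhin, J. reine angew. Math. 341 (1983)
Thm. 1.5.1, 1.6; D. Huybrechts, *Lectures on K3 Surfaces*, Ch. 3 Thm. 3.3.7, Rem. 3.3.14.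
-/

noncomputable section

set_option linter.dupNamespace false

open scoped TensorProduct
open Module CategoryTheory Polynomial
open Literature.AlgebraicTopology.SingularHomology Literature.Geometry.Kaehler
open Literature.AlgebraicGeometry Literature.AlgebraicGeometry.Motives Literature.AlgebraicGeometry.HodgeTheory
open Literature.AlgebraicGeometry.Motives.HodgeStructure
open Literature.AlgebraicGeometry.Hyperkaehler Literature.AlgebraicGeometry.Surfaces
open Summit.HodgeConjecture.HodgeConjecture.Theorems.NikulinTwinTransport
open Summit.HodgeConjecture.HodgeConjecture.Theorems.MarkmanPartnerTransport.BBFPositivity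
open Summit.HodgeConjecture.HodgeConjecture.Theorems.MarkmanPartnerTransport.LatticeBridge
open Summit.HodgeConjecture.HodgeConjecture.Theorems.MarkmanPartnerTransport.RealMultiplicationRanks

namespace Summit.HodgeConjecture.HodgeConjecture.Theorems.MarkmanPartnerTransport.PartnerLattice

/-! ### Abstract carriers: the degree of an element of a totally real `End_Hdg` -/

section Abstract

variable {V : Type*} [AddCommGroup V] [Module ℚ V] [Module.Finite ℚ V] {H : HodgeStructure V 2}

/-- **`dim_ℚ V = deg minpoly_ℚ(r) · n` with `n ≥ 3`** for every element `r` of the totally real endomorphism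
field `E` of an irreducible polarized Hodge structure of K3 type: `dim V = [E:ℚ] · m`, `m ≥ 3` (van Geemen) and
`[E:ℚ] = [ℚ(r):ℚ] · [E:ℚ(r)]`, `[ℚ(r):ℚ] = deg minpoly_ℚ(r)`. [cite: Vangeemen2008, Lemma 3.2] -/
theorem exists_natDegree_minpoly_mul (hirr : H.IsIrreducible) (hK3 : H.IsOfK3Type) (ψ : H.Polarization)
    (hF : IsField H.endAlg) (hreal : ∀ (φ : H.endAlg →+* ℂ) (a : H.endAlg), starRingEnd ℂ (φ a) = φ a)
    (r : H.endAlg) : ∃ n : ℕ, 3 ≤ n ∧ Module.finrank ℚ V = (minpoly ℚ r).natDegree * n := by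
  classical
  letI : Field H.endAlg := hF.toField
  haveI : Module.Finite ℚ H.endAlg := finiteDimensional_endAlg H
  haveI : Nontrivial V := hirr.nontrivial
  obtain ⟨m, hm, hdim⟩ := exists_three_le_finrank_eq_mul hirr hK3 ψ hF hreal
  have hint : IsIntegral ℚ r := Algebra.IsIntegral.isIntegral r
  set K : IntermediateField ℚ H.endAlg := IntermediateField.adjoin ℚ {r} with hKdef
  have hKk : Module.finrank ℚ K = (minpoly ℚ r).natDegree := by rw [hKdef, IntermediateField.adjoin.finrank hint]
  have htower : Module.finrank ℚ K * Module.finrank K H.endAlg = Module.finrank ℚ H.endAlg :=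
    Module.finrank_mul_finrank ℚ K H.endAlg
  have hpos : 0 < Module.finrank K H.endAlg := Module.finrank_pos
  refine ⟨Module.finrank K H.endAlg * m, by nlinarith, ?_⟩
  rw [hdim, ← htower, hKk, mul_assoc]

/-- An element of a field `E ⊇ ℚ` outside `ℚ` has minimal polynomial of degree `≥ 2`. [folklore] -/
theorem two_le_natDegree_minpoly_of_not_mem_bot (hF : IsField H.endAlg) {r : H.endAlg}
    (hr : r ∉ (⊥ : Subalgebra ℚ H.endAlg)) : 2 ≤ (minpoly ℚ r).natDegree := by
  classical
  letI : Field H.endAlg := hF.toField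
  haveI : Module.Finite ℚ H.endAlg := finiteDimensional_endAlg H
  have hint : IsIntegral ℚ r := Algebra.IsIntegral.isIntegral r
  have hpos : 0 < (minpoly ℚ r).natDegree := minpoly.natDegree_pos hint
  by_contra hlt
  have h1 : (minpoly ℚ r).natDegree = 1 := by omega
  apply hr
  rw [Algebra.mem_bot]
  exact minpoly.mem_range_of_degree_eq_one ℚ r
    (by rw [Polynomial.degree_eq_natDegree (minpoly.ne_zero hint), h1]; rfl)

/-- **The `(2,0)`-character value `ε(r)` of `r ∈ E ∖ ℚ` has `deg minpoly_ℚ ≥ 2` dividing `dim V` with cofactor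
`≥ 3`** (`minpoly_ℚ(ε r) = minpoly_ℚ(r)`, `minpoly.algHom_eq`; stated on the complex number so that concrete
consumers need no algebra on `E`). [cite: Vangeemen2008, Lemma 3.2] -/
theorem natDegree_minpoly_algHom_of_not_mem_bot (hirr : H.IsIrreducible) (hK3 : H.IsOfK3Type)
    (ψ : H.Polarization) (hF : IsField H.endAlg)
    (hreal : ∀ (φ : H.endAlg →+* ℂ) (a : H.endAlg), starRingEnd ℂ (φ a) = φ a)
    (ε : H.endAlg →ₐ[ℚ] ℂ) (hε : Function.Injective ε) {r : H.endAlg} (hr : r ∉ (⊥ : Subalgebra ℚ H.endAlg)) :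
    2 ≤ (minpoly ℚ (ε r)).natDegree ∧ ∃ n : ℕ, 3 ≤ n ∧ Module.finrank ℚ V = (minpoly ℚ (ε r)).natDegree * n := by
  rw [minpoly.algHom_eq ε hε]
  exact ⟨two_le_natDegree_minpoly_of_not_mem_bot hF hr, exists_natDegree_minpoly_mul hirr hK3 ψ hF hreal r⟩

end Abstract

/-- `MarkedK3Sq[X, φ, P, z]`: VERBATIM the `let MarkedK3Sq := …` binder of the route declarations of
MarkmanPartnerTransport (clauses (m1)–(m6)). Local notation only. -/
local notation3 (prettyPrint := false) "MarkedK3Sq[" X ", " φ ", " P ", " z "]" =>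
  (((IsIntegralClass P ∧ ∀ Q : complexBetti X (2 * 4), IsIntegralClass Q → ∃ n : ℤ, Q = n • P) ∧
    (∀ c : complexBetti X 2, IsIntegralClass c ↔ ∃ v : K3HilbertIndex → ℤ, φ c = fun i => (v i : ℂ)) ∧
    (∀ a : complexBetti X 2, cupPowTwo a 4 = ((3 : ℂ) * (k3HilbertForm 2 (φ a) (φ a)) ^ 2) • P) ∧
    (IsOfHodgeType 4 X 2 2 0 (LinearEquiv.symm φ z) ∧
      ∀ τ : complexBetti X 2, IsOfHodgeType 4 X 2 2 0 τ → ∃ t : ℂ, τ = t • LinearEquiv.symm φ z) ∧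
    (∀ c : complexBetti X 2, IsOfHodgeType 4 X 2 1 1 c ↔
      (k3HilbertForm 2 (φ c) z = 0 ∧ k3HilbertForm 2 (φ c) (star z) = 0)) ∧
    (k3HilbertForm 2 z z = 0 ∧ 0 < (k3HilbertForm 2 (star z) z).re)))

/-- `SpIso[X, φ]`: VERBATIM the `let SpannedByIsometries := …` binder of the route declarations (with
`IsBBFTransc` unfolded). Local notation only. -/
local notation3 (prettyPrint := false) "SpIso[" X ", " φ "]" =>
  (∀ f : complexBetti X 2 →ₗ[ℂ] complexBetti X 2, (∀ y, IsRationalClass y → IsRationalClass (f y)) →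
    (∀ (i j : ℕ) y, IsOfHodgeType 4 X 2 i j y → IsOfHodgeType 4 X 2 i j (f y)) →
    (∀ d : complexBetti X 2, d ∈ algebraicClasses X 1 → f d = 0) →
    (∀ y : complexBetti X 2, ∀ d : complexBetti X 2, d ∈ algebraicClasses X 1 →
      k3HilbertForm 2 (φ (f y)) (φ d) = 0) →
    ∃ (k : ℕ) (c : Fin k → ℚ) (g : Fin k → (complexBetti X 2 →ₗ[ℂ] complexBetti X 2)),
      (∀ i, Function.Bijective (g i) ∧ (∀ y, IsRationalClass y → IsRationalClass (g i y)) ∧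
        (∀ (a b : ℕ) y, IsOfHodgeType 4 X 2 a b y → IsOfHodgeType 4 X 2 a b (g i y)) ∧
        (∀ a b, k3HilbertForm 2 (φ (g i a)) (φ (g i b)) = k3HilbertForm 2 (φ a) (φ b))) ∧
      ∀ y : complexBetti X 2, (∀ d : complexBetti X 2, d ∈ algebraicClasses X 1 →
        k3HilbertForm 2 (φ y) (φ d) = 0) → f y = ∑ i : Fin k, ((c i : ℂ) • g i y))

/-- `RMdeg[X, φ, z]`: genuine real multiplication together with its DEGREE data — a rational, type-preserving
endomorphism `e` with `e σ = ev · σ`, `ev` real, `d = deg minpoly_ℚ(ev) ≥ 2` and `d · n + ρ(X) = 23` for some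
`n ≥ 3`. Local notation only. -/
local notation3 (prettyPrint := false) "RMdeg[" X ", " φ ", " z "]" =>
  (∃ e : complexBetti X 2 →ₗ[ℂ] complexBetti X 2, (∀ y, IsRationalClass y → IsRationalClass (e y)) ∧
    (∀ (i j : ℕ) y, IsOfHodgeType 4 X 2 i j y → IsOfHodgeType 4 X 2 i j (e y)) ∧
    ∃ ev : ℂ, e (LinearEquiv.symm φ z) = ev • LinearEquiv.symm φ z ∧ ev.im = 0 ∧
      2 ≤ (minpoly ℚ ev).natDegree ∧
      ∃ n : ℕ, 3 ≤ n ∧ (minpoly ℚ ev).natDegree * n + Module.finrank ℂ ↥(algebraicClasses X 1) = 23)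

/-- `qQ`: the rational Beauville–Bogomolov form on `ℚ²³`. -/
local notation3 (prettyPrint := false) "qQ" => Matrix.toBilin' (Matrix.map (k3HilbertGram 2) (Int.cast : ℤ → ℚ))

/-- `qC`: the complex Beauville–Bogomolov form on `ℂ²³`. -/
local notation3 (prettyPrint := false) "qC" => Matrix.toBilin' (Matrix.map (k3HilbertGram 2) (Int.cast : ℤ → ℂ))

variable {X : SchemeOver ℂ} {φ : complexBetti X 2 ≃ₗ[ℂ] (K3HilbertIndex → ℂ)} {P : complexBetti X (2 * 4)}
  {z : K3HilbertIndex → ℂ}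

/-- **The degree of the real multiplication forced by `¬ SpannedByIsometries`** (module docstring): there is a
rational, type-preserving endomorphism `e` of `H²(X(ℂ); ℂ)` with `e σ = ev · σ`, `ev` real,
`d = deg minpoly_ℚ(ev) ≥ 2` and `d · n = 23 − ρ(X)` for some `n ≥ 3`. Marking picture: the real-multiplication
endomorphism of `exists_realMultiplication_of_not_spannedByIsometries` reads in `E = End_Hdg(T(X)_ℚ)` as `r ∉ ℚ`
with `ε(r) = ev`, `minpoly_ℚ(ev) = minpoly_ℚ(r)` (`minpoly.algHom_eq`); `E` is totally real (a non-real character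
value would force `SpannedByIsometries`), and `exists_natDegree_minpoly_mul` applies with `dim T(X)_ℚ = 23 − ρ(X)`.
[cite: Vangeemen2008, Lemma 3.2] [cite: Zarhin1983HodgeGroupsK3, Thm. 1.5.1 and Thm. 1.6] -/
theorem exists_realMultiplication_degree_of_not_spannedByIsometries (hX : IsSmoothProjective 4 X)
    (hM : MarkedK3Sq[X, φ, P, z]) (hnsp : ¬ SpIso[X, φ]) : RMdeg[X, φ, z] := by
  classical
  obtain ⟨-, hint, -, ⟨hz20, hz20'⟩, h11, hzz, hzpos⟩ := id hM
  obtain ⟨NQ, hNQ⟩ := exists_ratNeronSeveri (X := X) φ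
  set D := periodDatum hX hM hNQ with hDdef
  have hDT : D.T = (qQ).orthogonal NQ := rfl
  have hDx : D.x = z := rfl
  have hDBC : ∀ a b, D.BC a b = k3HilbertForm 2 a b := fun a b => qC_apply a b
  clear_value D
  have hzne : z ≠ 0 := by
    intro h0
    rw [h0, k3HilbertForm_eq_dotProduct] at hzpos
    simp at hzpos
  set H := D.hodgeT with hH
  have hK3 : H.IsOfK3Type := D.isOfK3Type_hodgeT
  have hirr : H.IsIrreducible := D.isIrreducible_hodgeT
  set ψ : H.Polarization := D.polT with hψ
  obtain ⟨hFld, ε, hεinj, hε⟩ := Zarhin1983_endAlg_isField_holds H hirr hK3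
  have hω : D.omega ∈ H.piece 2 0 := D.omega_mem_piece
  have hrat : ∀ c, IsRationalClass c ↔ ∃ w : K3HilbertIndex → ℚ, φ c = fun i => (w i : ℂ) :=
    isRationalClass_iff_of_markedSq hX hint
  -- `dim_ℚ T = 23 - ρ(X)`
  have hdimT : Module.finrank ℚ ↥D.T + Module.finrank ℂ ↥(algebraicClasses X 1) = 23 := by
    have h := Submodule.finrank_add_eq_of_isCompl (isCompl_ratNeronSeveri_orthogonal hX hM hNQ)
    rw [finrank_ratNeronSeveri hX hint hNQ, finrank_rat23] at h
    rw [hDT]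
    omega
  -- the real-multiplication endomorphism, read in `E`
  obtain ⟨e, he_rat, he_typ, ev, he_ev, hev_im, hev_irr⟩ :=
    exists_realMultiplication_of_not_spannedByIsometries hX hM hnsp
  obtain ⟨τ, hτM, hτx, hτ11⟩ := exists_ratEnd_of_hodgeEndomorphism hX hM e he_rat he_typ
  have hτx' : ∃ c : ℂ, cxEnd τ D.x = c • D.x := by rw [hDx]; exact hτx
  have hτ11' : ∀ w : K3HilbertIndex → ℂ, D.BC w D.x = 0 → D.BC w (star D.x) = 0 →
      D.BC (cxEnd τ w) D.x = 0 ∧ D.BC (cxEnd τ w) (star D.x) = 0 := by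
    intro w h1 h2
    rw [hDBC, hDx] at h1 h2
    rw [hDBC, hDBC, hDx]
    exact hτ11 w h1 h2
  have hτT : ∀ t ∈ D.T, τ t ∈ D.T := fun t ht => D.map_mem_T τ hτx' ht
  have hr : τ.restrict hτT ∈ H.endAlg := D.restrict_mem_endAlg τ hτT hτx' hτ11'
  have hτMapp : ∀ v, cxEnd τ v = φ (e (φ.symm v)) := fun v => by rw [hτM]; rfl
  set r : H.endAlg := ⟨τ.restrict hτT, hr⟩ with hrdef
  have hεr : ε r = ev := by
    have h := hε r D.omega hω
    have h2 := congrArg (iota D.T) h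
    have hval : ((r : H.endAlg) : Module.End ℚ ↥D.T) = τ.restrict hτT := rfl
    rw [hval, D.iota_baseChange_restrict τ hτT, D.iota_omega, map_smul, D.iota_omega, hDx, hτMapp, he_ev, map_smul,
      LinearEquiv.apply_symm_apply] at h2
    have h3 : (ev - ε r) • z = 0 := by rw [sub_smul, h2, sub_self]
    rcases smul_eq_zero.1 h3 with h4 | h4
    · exact (sub_eq_zero.1 h4).symm
    · exact absurd h4 hzne
  have hr_bot : r ∉ (⊥ : Subalgebra ℚ H.endAlg) := by
    intro h
    rw [Algebra.mem_bot] at h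
    obtain ⟨a, ha⟩ := h
    apply hev_irr a
    rw [← hεr, ← ha, AlgHom.commutes, eq_ratCast]
  -- `E` is totally real: a non-real character value would force `SpannedByIsometries`
  have hreal : ∀ (φ' : H.endAlg →+* ℂ) (a : H.endAlg), starRingEnd ℂ (φ' a) = φ' a := by
    by_contra hnot
    push Not at hnot
    obtain ⟨φ', a, hφ'a⟩ := hnot
    obtain ⟨hadjex, hadjconj⟩ := Zarhin1983_adjoint_eq_conj_holds H hirr hK3 ψ
    obtain ⟨a', ha'⟩ := hadjex a
    have hne : a' ≠ a := by
      intro h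
      apply hφ'a
      have key := hadjconj a a' ha' φ'
      rw [h] at key
      exact key.symm
    have hμ : (ε a).im ≠ 0 := by
      intro him
      apply hne
      apply hεinj
      have key := hadjconj a a' ha' ε.toRingHom
      change ε a' = starRingEnd ℂ (ε a) at key
      rw [key]
      exact Complex.conj_eq_iff_im.2 him
    -- `a` extended by `id_N`
    set û : Module.End ℚ (K3HilbertIndex → ℚ) := D.extendT (a : Module.End ℚ ↥D.T) with hû
    have hûz : cxEnd û z = ε a • z := by
      have h := hε a D.omega hω
      have h2 := congrArg (iota D.T) h
      rw [D.iota_baseChange, D.iota_omega, map_smul, D.iota_omega, hDx] at h2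
      exact h2
    have hû11 : ∀ w : K3HilbertIndex → ℂ, k3HilbertForm 2 w z = 0 → k3HilbertForm 2 w (star z) = 0 →
        k3HilbertForm 2 (cxEnd û w) z = 0 ∧ k3HilbertForm 2 (cxEnd û w) (star z) = 0 := by
      intro w h1 h2
      have h := D.BC_cxEnd_extendT a.2 (z := w) (by rw [hDBC, hDx]; exact h1) (by rw [hDBC, hDx]; exact h2)
      rwa [hDBC, hDBC, hDx] at h
    let Ψ : complexBetti X 2 →ₗ[ℂ] complexBetti X 2 := φ.symm.toLinearMap ∘ₗ cxEnd û ∘ₗ φ.toLinearMap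
    have hΨapp : ∀ y, Ψ y = φ.symm (cxEnd û (φ y)) := fun y => rfl
    have hΨrat : ∀ y, IsRationalClass y → IsRationalClass (Ψ y) := by
      intro y hy
      obtain ⟨w, hw⟩ := (hrat y).1 hy
      rw [hΨapp, hw, cxEnd_ratVec]
      exact (hrat _).2 ⟨û w, LinearEquiv.apply_symm_apply _ _⟩
    have hΨσ : Ψ (φ.symm z) = ε a • φ.symm z := by rw [hΨapp, LinearEquiv.apply_symm_apply, hûz, map_smul]
    have hΨ11 : ∀ y, IsOfHodgeType 4 X 2 1 1 y → IsOfHodgeType 4 X 2 1 1 (Ψ y) := by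
      intro y hy
      obtain ⟨h1, h2⟩ := (h11 y).1 hy
      rw [hΨapp, h11, LinearEquiv.apply_symm_apply]
      exact hû11 (φ y) h1 h2
    exact hnsp (spannedByIsometries_of_cm hX hM Ψ hΨrat hΨ11 hΨσ hμ)
  -- degrees
  obtain ⟨h2, n, hn, hdim⟩ := natDegree_minpoly_algHom_of_not_mem_bot hirr hK3 ψ hFld hreal ε hεinj hr_bot
  rw [hεr] at h2 hdim
  exact ⟨e, he_rat, he_typ, ev, he_ev, hev_im, h2, n, hn, by rw [← hdim]; exact hdimT⟩

/-! ### The admissible degrees at `ρ(X) = 1, 2, 3` -/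

/-- `d · n = 21` with `d ≥ 2`, `n ≥ 3` forces `d ∈ {3, 7}`. [folklore] -/
theorem eq_three_or_seven_of_mul_eq {d n : ℕ} (hd : 2 ≤ d) (hn : 3 ≤ n) (h : d * n = 21) : d = 3 ∨ d = 7 := by
  have hd7 : d ≤ 7 := by nlinarith
  interval_cases d <;> omega

/-- `d · n = 22` with `d ≥ 2`, `n ≥ 3` forces `d = 2`. [folklore] -/
theorem eq_two_of_mul_eq {d n : ℕ} (hd : 2 ≤ d) (hn : 3 ≤ n) (h : d * n = 22) : d = 2 := by
  have hd7 : d ≤ 7 := by nlinarith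
  interval_cases d <;> omega

/-- `d · n = 20` with `d ≥ 2`, `n ≥ 3` forces `d ∈ {2, 4, 5}`. [folklore] -/
theorem eq_two_four_five_of_mul_eq {d n : ℕ} (hd : 2 ≤ d) (hn : 3 ≤ n) (h : d * n = 20) :
    d = 2 ∨ d = 4 ∨ d = 5 := by
  have hd6 : d ≤ 6 := by nlinarith
  interval_cases d <;> omega

/-- **At `ρ(X) = 2`, `¬ SpannedByIsometries` means real multiplication met through an eigenvalue of degree `3` or
`7`** (`dim T(X)_ℚ = 21 = d · n`, `n ≥ 3`, `d ≥ 2`). So the one-cycle clause of crux #5 asks, at `ρ(X) = 2`, for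
an algebraic class acting on the symplectic form by a cubic or septic (totally real) irrationality.
[cite: Vangeemen2008, Lemma 3.2] [cite: Zarhin1983HodgeGroupsK3, Thm. 1.5.1] -/
theorem natDegree_realMultiplication_of_picard_two (hX : IsSmoothProjective 4 X) (hM : MarkedK3Sq[X, φ, P, z])
    (hnsp : ¬ SpIso[X, φ]) (hρ2 : Module.finrank ℂ ↥(algebraicClasses X 1) = 2) :
    ∃ e : complexBetti X 2 →ₗ[ℂ] complexBetti X 2, (∀ y, IsRationalClass y → IsRationalClass (e y)) ∧
      (∀ (i j : ℕ) y, IsOfHodgeType 4 X 2 i j y → IsOfHodgeType 4 X 2 i j (e y)) ∧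
      ∃ ev : ℂ, e (φ.symm z) = ev • φ.symm z ∧ ev.im = 0 ∧
        ((minpoly ℚ ev).natDegree = 3 ∨ (minpoly ℚ ev).natDegree = 7) := by
  obtain ⟨e, he_rat, he_typ, ev, he_ev, hev_im, h2, n, hn, hdn⟩ :=
    exists_realMultiplication_degree_of_not_spannedByIsometries hX hM hnsp
  exact ⟨e, he_rat, he_typ, ev, he_ev, hev_im, eq_three_or_seven_of_mul_eq h2 hn (by omega)⟩

/-- **At `ρ(X) = 1`, `¬ SpannedByIsometries` means real multiplication by a real QUADRATIC irrationality**
(`22 = d · n`, `n ≥ 3`, `d ≥ 2` forces `d = 2`). [cite: Vangeemen2008, Lemma 3.2] [cite: Zarhin1983HodgeGroupsK3, Thm. 1.5.1] -/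
theorem natDegree_realMultiplication_of_picard_one (hX : IsSmoothProjective 4 X) (hM : MarkedK3Sq[X, φ, P, z])
    (hnsp : ¬ SpIso[X, φ]) (hρ1 : Module.finrank ℂ ↥(algebraicClasses X 1) = 1) :
    ∃ e : complexBetti X 2 →ₗ[ℂ] complexBetti X 2, (∀ y, IsRationalClass y → IsRationalClass (e y)) ∧
      (∀ (i j : ℕ) y, IsOfHodgeType 4 X 2 i j y → IsOfHodgeType 4 X 2 i j (e y)) ∧
      ∃ ev : ℂ, e (φ.symm z) = ev • φ.symm z ∧ ev.im = 0 ∧ (minpoly ℚ ev).natDegree = 2 := by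
  obtain ⟨e, he_rat, he_typ, ev, he_ev, hev_im, h2, n, hn, hdn⟩ :=
    exists_realMultiplication_degree_of_not_spannedByIsometries hX hM hnsp
  exact ⟨e, he_rat, he_typ, ev, he_ev, hev_im, eq_two_of_mul_eq h2 hn (by omega)⟩

/-- **At `ρ(X) = 3`, `¬ SpannedByIsometries` means real multiplication met through an eigenvalue of degree `2`,
`4` or `5`** (`20 = d · n`, `n ≥ 3`, `d ≥ 2`). [cite: Vangeemen2008, Lemma 3.2] [cite: Zarhin1983HodgeGroupsK3, Thm. 1.5.1] -/
theorem natDegree_realMultiplication_of_picard_three (hX : IsSmoothProjective 4 X) (hM : MarkedK3Sq[X, φ, P, z])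
    (hnsp : ¬ SpIso[X, φ]) (hρ3 : Module.finrank ℂ ↥(algebraicClasses X 1) = 3) :
    ∃ e : complexBetti X 2 →ₗ[ℂ] complexBetti X 2, (∀ y, IsRationalClass y → IsRationalClass (e y)) ∧
      (∀ (i j : ℕ) y, IsOfHodgeType 4 X 2 i j y → IsOfHodgeType 4 X 2 i j (e y)) ∧
      ∃ ev : ℂ, e (φ.symm z) = ev • φ.symm z ∧ ev.im = 0 ∧
        ((minpoly ℚ ev).natDegree = 2 ∨ (minpoly ℚ ev).natDegree = 4 ∨ (minpoly ℚ ev).natDegree = 5) := by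
  obtain ⟨e, he_rat, he_typ, ev, he_ev, hev_im, h2, n, hn, hdn⟩ :=
    exists_realMultiplication_degree_of_not_spannedByIsometries hX hM hnsp
  exact ⟨e, he_rat, he_typ, ev, he_ev, hev_im, eq_two_four_five_of_mul_eq h2 hn (by omega)⟩

end Summit.HodgeConjecture.HodgeConjecture.Theorems.MarkmanPartnerTransport.PartnerLattice

end
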